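import Mathlib.LinearAlgebra.Matrix.BilinearForm
import Summits.HodgeConjecture.HodgeConjecture.Theorems.LinearSystemTorelliLocalTubeSpanThinRepMu
import Summits.HodgeConjecture.HodgeConjecture.Theorems.LinearSystemTorelliLocalTubeSpanThinDynamicsMu
import Summits.HodgeConjecture.HodgeConjecture.Theorems.LinearSystemTorelliLocalTubeSpanThinClassification
import Summits.HodgeConjecture.HodgeConjecture.Theorems.LinearSystemTorelliLocalTubeSpanThinCocycleMu

/-!
# Route LinearSystemTorelli — crux `LocalTubeSpan`: the thin boundary for every pairing `μ ≥ 4`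

Helper file (`--supports stmt-HodgeConjecture-2490`, line `Sketch`, cycle-4 wave-3 composition
`exists_thinConfiguration_not_injective_of_four_le`).  The cycle-3 file `…Thin` exhibits ONE integral
symplectic transvection configuration (`δ₁, δ₂, δ₁ + δ₂` with `⟨δ₁, δ₂⟩ = 4`) for which Schnell's third
map `H¹(G, V) → ∏_g V/(g - 1)V` is not injective.  This file gives the whole family:

* `localTubeSpan_exists_thinConfiguration_not_injective_of_four_le` — for EVERY integer `μ ≥ 4`
  there is a finitely generated group acting on a 2-dimensional `ℚ`-space through integral symplectic
  transvections of a nondegenerate alternating form along three cycles `e t₃ = e t₁ + e t₂` with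
  `B(e t₁, e t₂) = μ`, whose third map is NOT injective (`…ThinRepMu`, `…ThinDynamicsMu`,
  `…ThinClassification`, `…ThinCocycleMu`: the same three-cone ping-pong, thin free image, the relation
  `e t₁ + e t₂ - e t₃` an undetected non-coboundary).

With `…RankTwoPairingOne/Two/Three` (injective for `μ = 1, 2, 3`, the last by WORD detection at the
fourth cusp of `Γ(3)`) this CLASSIFIES the triangle configuration: cyclic detection holds iff
`|μ| ≤ 3` (negative pairings by the symmetry `B ↦ -B`, not spelled out).  Todd–Coxeter evidence (item
evidence `gamma3_index.py`): the image has index `1, 6, 12, ∞, ∞` in `PSL₂(ℤ)` for `μ = 1, …, 5`.  For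
the crux: a geometric counterexample to LocalTubeSpan needs a genuinely THIN local image, which is more
than the absence of a finite-index transvection frame.

References: [Schnell2010] C. Schnell, Primitive cohomology and the tube mapping, Math. Z. 268 (2010)
§7; the ping-pong lemma (folklore, Lyndon–Schupp III.12).
-/

-- `Summit.HodgeConjecture.HodgeConjecture.Theorems` is the mandated namespace (single-conjunct summit:
-- Sub = Summit), which `linter.dupNamespace` flags on every declaration; the lakefile turns the
-- linter off tree-wide (weak option), restated here so stand-alone elaboration is warning-free too.
set_option linter.dupNamespace false

noncomputable section

open CategoryTheory groupCohomology
open Literature.AlgebraicGeometry.HodgeTheory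

namespace Summit.HodgeConjecture.HodgeConjecture.Theorems

/-- **The thin boundary for every pairing `μ ≥ 4`.**  For every integer `μ ≥ 4` there is a finitely
generated group `G` acting on a 2-dimensional `ℚ`-space `V` through integral symplectic transvections
`x ↦ x - B(x, e_t) e_t` of a nondegenerate alternating form `B` along three cycles with
`e t₃ = e t₁ + e t₂` and `B(e t₁, e t₂) = μ`, such that Schnell's third map
`H¹(G, V) → ∏_{g ∈ G} V/(g - 1)V` is not injective. [folklore] -/
theorem localTubeSpan_exists_thinConfiguration_not_injective_of_four_le (μ : ℤ) (hμ : 4 ≤ μ) :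
    ∃ (G : Type) (_ : Group G) (A : Rep ℚ G) (B : LinearMap.BilinForm ℚ A.V) (s : Set G)
      (e : G → A.V), B.Nondegenerate ∧ B.IsAlt ∧ s.Finite ∧ Subgroup.closure s = ⊤ ∧
      (∀ t ∈ s, ∀ x : A.V, A.ρ t x = x - B x (e t) • e t) ∧
      (∀ t ∈ s, ∀ t' ∈ s, ∃ n : ℤ, B (e t) (e t') = n) ∧
      Module.finrank ℚ A.V = 2 ∧
      (∃ t₁ ∈ s, ∃ t₂ ∈ s, ∃ t₃ ∈ s, e t₃ = e t₁ + e t₂ ∧ B (e t₁) (e t₂) = μ) ∧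
      ¬ Function.Injective (evalCoinv A) := by
  classical
  have hμQ : (4 : ℚ) ≤ (μ : ℚ) := by exact_mod_cast hμ
  have hμ0 : (μ : ℚ) ≠ 0 := by
    have : (0 : ℚ) < (μ : ℚ) := by linarith
    exact this.ne'
  obtain ⟨ρ, h0, h1, h2⟩ := localTubeSpan_exists_thinRepMu (μ : ℚ)
  -- the dichotomy for the free group, from the dynamics
  have hclass := localTubeSpan_thinClassification ρ FreeGroup.of (FreeGroup.closure_range_of _)
    (fun L hL0 hLc a b ha hb hab =>
      localTubeSpan_thinDynamicsMu (μ : ℚ) hμQ ρ FreeGroup.of h0 h1 h2 L hL0 hLc a b ha hb hab)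
  have hthin := localTubeSpan_not_injective_evalCoinv_thinMu (μ : ℚ) hμ0 ρ h0 h1 h2 hclass
  -- the data
  let d : Fin 3 → (Fin 2 → ℚ) := ![![1, 0], ![0, 1], ![1, 1]]
  have hd0 : d 0 = ![1, 0] := rfl
  have hd1 : d 1 = ![0, 1] := rfl
  have hd2 : d 2 = ![1, 1] := rfl
  let B : LinearMap.BilinForm ℚ (Fin 2 → ℚ) := Matrix.toBilin' !![(0 : ℚ), μ; -μ, 0]
  have hBapply : ∀ x y : Fin 2 → ℚ, B x y = (μ : ℚ) * (x 0 * y 1 - x 1 * y 0) := fun x y => by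
    change Matrix.toBilin' !![(0 : ℚ), μ; -μ, 0] x y = _
    rw [Matrix.toBilin'_apply']
    simp [Matrix.mulVec, dotProduct, Fin.sum_univ_two]
    ring
  let e : FreeGroup (Fin 3) → (Fin 2 → ℚ) := fun g =>
    if hg : ∃ i, FreeGroup.of i = g then d (Classical.choose hg) else 0
  have he : ∀ i, e (FreeGroup.of i) = d i := fun i => by
    have hg : ∃ j, FreeGroup.of j = FreeGroup.of i := ⟨i, rfl⟩
    change (if hg : ∃ j, FreeGroup.of j = FreeGroup.of i then d (Classical.choose hg) else 0) = d i
    rw [dif_pos hg, FreeGroup.of_injective (Classical.choose_spec hg)]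
  refine ⟨FreeGroup (Fin 3), inferInstance, Rep.of ρ, B, Set.range FreeGroup.of, e, ?_, ?_,
    Set.finite_range _, FreeGroup.closure_range_of _, ?_, ?_, Module.finrank_fin_fun ℚ, ?_, hthin⟩
  · -- nondegenerate: `det = μ²`
    refine LinearMap.BilinForm.nondegenerate_toBilin'_iff_det_ne_zero.2 ?_
    rw [Matrix.det_fin_two_of]
    have : (0 : ℚ) * 0 - (μ : ℚ) * -(μ : ℚ) = (μ : ℚ) * μ := by ring
    rw [this]
    exact mul_ne_zero hμ0 hμ0
  · -- alternating
    intro x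
    rw [hBapply]
    ring
  · -- the generators act as the transvections along `d i`
    have key : ∀ (i : Fin 3) (x : Fin 2 → ℚ), ρ (FreeGroup.of i) x = x - B x (d i) • d i := by
      intro i x
      rw [hBapply]
      match i with
      | 0 => rw [h0, hd0]; ext j; fin_cases j <;> simp
      | 1 => rw [h1, hd1]; ext j; fin_cases j <;> simp
      | 2 => rw [h2, hd2]; ext j; fin_cases j <;> simp
    rintro _ ⟨i, rfl⟩ x
    rw [he]
    exact key i x
  · -- integral pairings (`0, ±μ`)
    have key : ∀ i j : Fin 3, ∃ n : ℤ, B (d i) (d j) = n := by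
      intro i j
      rw [hBapply]
      match i, j with
      | 0, 0 => exact ⟨0, by norm_num [hd0]⟩
      | 0, 1 => exact ⟨μ, by norm_num [hd0, hd1]⟩
      | 0, 2 => exact ⟨μ, by norm_num [hd0, hd2]⟩
      | 1, 0 => exact ⟨-μ, by norm_num [hd0, hd1]⟩
      | 1, 1 => exact ⟨0, by norm_num [hd1]⟩
      | 1, 2 => exact ⟨-μ, by norm_num [hd1, hd2]⟩
      | 2, 0 => exact ⟨-μ, by norm_num [hd0, hd2]⟩
      | 2, 1 => exact ⟨μ, by norm_num [hd1, hd2]⟩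
      | 2, 2 => exact ⟨0, by norm_num [hd2]⟩
    rintro _ ⟨i, rfl⟩ _ ⟨j, rfl⟩
    rw [he, he]
    exact key i j
  · refine ⟨FreeGroup.of 0, ⟨0, rfl⟩, FreeGroup.of 1, ⟨1, rfl⟩, FreeGroup.of 2, ⟨2, rfl⟩, ?_, ?_⟩
    · rw [he, he, he, hd0, hd1, hd2]; ext j; fin_cases j <;> simp
    · rw [he, he, hBapply, hd0, hd1]; norm_num


end Summit.HodgeConjecture.HodgeConjecture.Theorems

end
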